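import Summits.CriticalPhenomena.PercolationContinuityZ3.Theorems.PercNearOneGluingNoHeavyLowerTailFrontierDecRowsUnmarkedEdgeInduction
import Summits.CriticalPhenomena.PercolationContinuityZ3.Theorems.PercNearOneGluingNoHeavyLowerTailFrontierDecRowsTerminalEdgeStep
import Literature.Probability.Percolation.KozmaNitzanPinning
import Summits.CriticalPhenomena.PercolationContinuityZ3.Theorems.PercNearOneGluingNoHeavyLowerTailCILSharpHardnessHub
import HarnessLib

/-!
# The UNMARKED-EDGE induction schema, II: pendant clones remove the invariant —
# every `k`-terminal pattern row on every finite weighted graph follows from its (terminal, unmarked) edge forms alone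

Support file (prover seat `prim-bnk-1`, gen 8; `--supports stmt-CriticalPhenomena-4575`).  No named facts, no sorries, no `native_decide`;
bookkeeping definitions `pev`, `sepPat`, `cloneWeight`, `cloneProj`.  Sequel of `…FrontierDecRowsUnmarkedEdgeInduction`.

CLONES.  Given `w` on `Fin n` and an injective marking `x : Fin k → Fin n`, embed `Fin n ↪ Fin (n + k)` by `Fin.castAdd k` and attach to each
terminal `x i` the pendant CLONE `Fin.natAdd n i` by an edge of weight `1`; old pairs keep their weight, all other new pairs get weight `0`
(`cloneWeight`, via `Function.extend` along the injective `Sym2.map (Fin.castAdd k)`).  Then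
* the law of the old edges is `prodBernoulli w`: `(prodBernoulli (cloneWeight w x)).map (restrictConfig (Fin.castAdd k)) = prodBernoulli w`
  (`map_restrictConfig_cloneWeight`, from the tree's `prodBernoulli_map_restrictConfig`, Kozma–Nitzan pinning file);
* almost surely a clone is joined to its terminal and to nothing else (`eq_of_clone_adj`), so connectivity among old vertices is that of the
  restricted configuration (`reachable_castAdd_iff`, via the projection `cloneProj`); hence every pattern event of the cloned marking is a.s. the
  pull-back of the pattern event of the old marking (`preimage_pev_ae`) and `E₃` is unchanged (`sahiE3_clone`);
* the cloned marking has spares (`hasSpare_clone`).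
**Theorem (`sahiE3_pev_nonneg_of_unmarkedEdgeHyp`).**  For three `k`-terminal pattern predicates `Φ₁ Φ₂ Φ₃` (`pev Φ x` = the `connEvent` of
`Φ` read at the marking `x`): `(∀ m, UnmarkedEdgeHyp (pev Φ₁ ·) (pev Φ₂ ·) (pev Φ₃ ·) on Fin m) → ∀ n w x, Injective x → 0 ≤ E₃(pev Φ₁ x, pev Φ₂ x,
pev Φ₃ x)` under `prodBernoulli w` — by the invariant version applied to the cloned graph one dimension up.  Group-separation form
`sahiE3_sep_nonneg_of_unmarkedEdgeHyp` (three `D[X|Y]` with `X, Y` sub-lists of the terminals; `sepPat`, `pev_sepPat`), and the 45 frontier rows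
`frontier_all_of_unmarkedEdgeHyp (i : Fin 45)`.
CONSEQUENCE FOR THE OPEN ROWS.  PATH (row 36) for all `n` ⟸ the five-point polarised forms at the edge types (leaf `c` or `y`, unmarked `u`) and
(hub `a` or `b`, unmarked `u`); row 44 ⟸ the forms at (`a`, unmarked `u`) up to its symmetry; similarly rows 12, 15, 27, 30, 37 — each a pair of
cubic inequalities `B₁, B₂ ≥ 0` in the 52-cell law of `(a,b,c,y,u)` under `w[e↦0]` with the induction-hypothesis rows `E₃ ≥ 0` under `w[e↦0]`,
`w[e↦1]` (`…FrontierDecRowsTerminalEdgeStep` for the one-law rewriting).  The terminal–terminal certificates (prim-l12-p1, kit j094120/j094121) are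
no longer needed.
-/

noncomputable section

namespace Summit.CriticalPhenomena.PercolationContinuityZ3.Theorems

namespace TerminalEdgeInduction

open MeasureTheory Literature.Probability.Percolation Literature.Probability.LatticeModels
open EdgeInduction CovTransferCert E3GroupSepCert
open scoped Classical

variable {n k : ℕ}

/-! ### Pattern predicates read at a marking -/

/-- The event of a `k`-terminal pattern predicate `Φ` (a Boolean function of the `k × k` connectivity matrix) read at the marking `x`. [this work] -/
def pev (Φ : (Fin k → Fin k → Bool) → Bool) (x : Fin k → Fin n) : Set (BondConfig (Fin n)) :=
  connEvent (fun r => Φ (fun i j => r (x i) (x j)))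

/-- Pattern-predicate events are local families. [this work] -/
theorem isLocal_pev (Φ : (Fin k → Fin k → Bool) → Bool) : IsLocal (fun x : Fin k → Fin n => pev Φ x) :=
  isLocal_connEvent Φ

/-- Membership in a pattern-predicate event. [this work] -/
theorem mem_pev_iff (Φ : (Fin k → Fin k → Bool) → Bool) (x : Fin k → Fin n) (ω : BondConfig (Fin n)) :
    ω ∈ pev Φ x ↔ Φ (fun i j => decide (ω ∈ openConn (x i) (x j))) = true := Iff.rfl

/-- The group separation `D[X|Y]` of two sub-lists of the terminals as a pattern predicate. [this work] -/
def sepPat (I J : List (Fin k)) : (Fin k → Fin k → Bool) → Bool :=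
  fun M => I.all fun i => J.all fun j => !(M i j)

/-- `pev (sepPat I J) x = connEvent (sep (I.map x) (J.map x))`. [this work] -/
theorem pev_sepPat (I J : List (Fin k)) (x : Fin k → Fin n) :
    pev (sepPat I J) x = connEvent (sep (I.map x) (J.map x)) := by
  unfold pev
  congr 1
  funext r
  simp only [sepPat, sep, List.all_map]
  rfl

/-! ### Pendant clones: every marking acquires spares one dimension up

Embed `Fin n` into `Fin (n + k)` by `Fin.castAdd k` and give the terminal `x i` the CLONE `Fin.natAdd n i`, joined to it by an edge of weight
`1`; every other new edge has weight `0` and old edges keep their weights (`cloneWeight`).  Almost surely a clone hangs on its terminal and on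
nothing else, so connectivity among old vertices is that of the restricted configuration (`reachable_castAdd_iff`), whose law is
`prodBernoulli w` (the tree's `prodBernoulli_map_restrictConfig`, Kozma–Nitzan pinning file): `E₃` of pattern events is unchanged
(`sahiE3_clone`), and the cloned marking has spares (`hasSpare_clone`). -/

section Clone

/-- Every vertex of `Fin (n + k)` is an old vertex or a clone. [folklore] -/
theorem castAdd_or_natAdd (v : Fin (n + k)) : (∃ u : Fin n, Fin.castAdd k u = v) ∨ (∃ i : Fin k, Fin.natAdd n i = v) := by
  by_cases h : (v : ℕ) < n
  · exact Or.inl ⟨⟨v, h⟩, Fin.ext rfl⟩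
  · refine Or.inr ⟨⟨v - n, by omega⟩, Fin.ext ?_⟩
    simp only [Fin.natAdd]
    omega

/-- A pair with a clone end is not the image of an old pair. [folklore] -/
theorem not_exists_map_eq_natAdd (i : Fin k) (q : Fin (n + k)) :
    ¬ ∃ a : Sym2 (Fin n), Sym2.map (Fin.castAdd k) a = s(Fin.natAdd n i, q) := by
  rintro ⟨a, ha⟩
  induction a using Sym2.ind with
  | h p r =>
      rw [Sym2.map_mk, Sym2.eq_iff] at ha
      rcases ha with ⟨h1, -⟩ | ⟨-, h2⟩
      · exact CILSharpHardness.castAdd_ne_natAdd p i h1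
      · exact CILSharpHardness.castAdd_ne_natAdd r i h2

variable (w : Sym2 (Fin n) → unitInterval) (x : Fin k → Fin n)

/-- **Clone weights** on `Fin (n + k)`: old pairs keep their weight, the pair (clone `i`, terminal `x i`) has weight `1`, all other new pairs
weight `0`. [this work] -/
def cloneWeight : Sym2 (Fin (n + k)) → unitInterval :=
  Function.extend (Sym2.map (Fin.castAdd k)) w
    (fun e => if ∃ i : Fin k, e = s(Fin.natAdd n i, Fin.castAdd k (x i)) then 1 else 0)

/-- Old pairs keep their weight. [this work] -/
theorem cloneWeight_map (e : Sym2 (Fin n)) : cloneWeight w x (Sym2.map (Fin.castAdd k) e) = w e :=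
  (Sym2.map.injective (Fin.castAdd_injective n k)).extend_apply _ _ _

/-- As a function on old pairs the clone weight IS `w`. [this work] -/
theorem cloneWeight_comp_map : cloneWeight w x ∘ Sym2.map (Fin.castAdd k) = w :=
  funext (cloneWeight_map w x)

/-- The clone edges have weight one. [this work] -/
theorem cloneWeight_clone (i : Fin k) : cloneWeight w x s(Fin.natAdd n i, Fin.castAdd k (x i)) = 1 := by
  unfold cloneWeight
  rw [Function.extend_apply' _ _ _ (not_exists_map_eq_natAdd i _), if_pos ⟨i, rfl⟩]

/-- Every other pair at a clone has weight zero. [this work] -/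
theorem cloneWeight_natAdd_of_ne (i : Fin k) {q : Fin (n + k)} (hq : q ≠ Fin.castAdd k (x i)) :
    cloneWeight w x s(Fin.natAdd n i, q) = 0 := by
  unfold cloneWeight
  rw [Function.extend_apply' _ _ _ (not_exists_map_eq_natAdd i _), if_neg]
  rintro ⟨i', h⟩
  rw [Sym2.eq_iff] at h
  rcases h with ⟨h1, h2⟩ | ⟨h1, -⟩
  · have hii : i = i' := Fin.natAdd_injective k n h1  -- check arg order
    subst hii
    exact hq h2
  · exact (CILSharpHardness.castAdd_ne_natAdd (x i') i h1.symm).elim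

/-- **The law of the old edges under the clone weights is `prodBernoulli w`.** [this work] -/
theorem map_restrictConfig_cloneWeight :
    (prodBernoulli (cloneWeight w x)).map (restrictConfig (Fin.castAdd k)) = prodBernoulli w := by
  rw [prodBernoulli_map_restrictConfig (cloneWeight w x) (Fin.castAdd_injective n k), cloneWeight_comp_map]

/-- Probabilities of preimages under restriction are `prodBernoulli w`-probabilities. [this work] -/
theorem real_preimage_restrictConfig_cloneWeight (S : Set (BondConfig (Fin n))) :
    (prodBernoulli (cloneWeight w x)).real (restrictConfig (Fin.castAdd k) ⁻¹' S) = (prodBernoulli w).real S := by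
  rw [← map_restrictConfig_cloneWeight w x, measureReal_def, measureReal_def,
    Measure.map_apply (measurable_restrictConfig _) (Set.toFinite S).measurableSet]

/-- Almost surely (on `good`), an open pair at a clone is its clone edge. [this work] -/
theorem eq_of_clone_adj {ω : BondConfig (Fin (n + k))} (hω : ω ∈ good (cloneWeight w x)) (i : Fin k) {q : Fin (n + k)}
    (h : (openGraph ω).Adj (Fin.natAdd n i) q) : q = Fin.castAdd k (x i) := by
  by_contra hq
  rw [openGraph_adj] at h
  exact (hω _).2 (cloneWeight_natAdd_of_ne w x i hq) h.1

/-- The projection `Fin (n + k) → Fin n`: old vertices to themselves, the clone of terminal `i` to `x i`. [this work] -/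
def cloneProj : Fin (n + k) → Fin n :=
  Fin.addCases (motive := fun _ => Fin n) (fun u => u) (fun i => x i)

/-- `cloneProj` on old vertices. [this work] -/
theorem cloneProj_castAdd (u : Fin n) : cloneProj x (Fin.castAdd k u) = u := by
  simp [cloneProj, Fin.addCases_left]

/-- `cloneProj` on clones. [this work] -/
theorem cloneProj_natAdd (i : Fin k) : cloneProj x (Fin.natAdd n i) = x i := by
  simp [cloneProj, Fin.addCases_right]

/-- On `good`, an open edge of the big graph projects to an equality or to an open edge of the restricted configuration. [this work] -/
theorem cloneProj_adj {ω : BondConfig (Fin (n + k))} (hω : ω ∈ good (cloneWeight w x)) {p q : Fin (n + k)}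
    (h : (openGraph ω).Adj p q) :
    cloneProj x p = cloneProj x q ∨ (openGraph (restrictConfig (Fin.castAdd k) ω)).Adj (cloneProj x p) (cloneProj x q) := by
  rcases castAdd_or_natAdd p with ⟨u, rfl⟩ | ⟨i, rfl⟩
  · rcases castAdd_or_natAdd q with ⟨v, rfl⟩ | ⟨j, rfl⟩
    · right
      rw [cloneProj_castAdd, cloneProj_castAdd, openGraph_adj, mem_restrictConfig, Sym2.map_mk]
      rw [openGraph_adj] at h
      exact ⟨h.1, fun huv => h.2 (by rw [huv])⟩
    · left
      have := eq_of_clone_adj w x hω j h.symm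
      rw [cloneProj_castAdd, cloneProj_natAdd, Fin.castAdd_injective n k this]
  · left
    have := eq_of_clone_adj w x hω i h
    subst this
    rw [cloneProj_castAdd, cloneProj_natAdd]

/-- **On `good`, connectivity among old vertices in the big graph is connectivity in the restricted configuration.** [this work] -/
theorem reachable_castAdd_iff {ω : BondConfig (Fin (n + k))} (hω : ω ∈ good (cloneWeight w x)) (u v : Fin n) :
    (openGraph ω).Reachable (Fin.castAdd k u) (Fin.castAdd k v) ↔ (openGraph (restrictConfig (Fin.castAdd k) ω)).Reachable u v := by
  constructor
  · intro h
    suffices H : ∀ p q, (openGraph ω).Reachable p q → (openGraph (restrictConfig (Fin.castAdd k) ω)).Reachable (cloneProj x p) (cloneProj x q) by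
      simpa only [cloneProj_castAdd] using H _ _ h
    intro p q hpq
    rw [SimpleGraph.reachable_iff_reflTransGen] at hpq
    induction hpq with
    | refl => exact SimpleGraph.Reachable.refl _
    | @tail b c _ hbc ih =>
        rcases cloneProj_adj w x hω hbc with h' | h'
        · rw [← h']; exact ih
        · exact ih.trans h'.reachable
  · intro h
    rw [SimpleGraph.reachable_iff_reflTransGen] at h
    induction h with
    | refl => exact SimpleGraph.Reachable.refl _
    | @tail b c _ hbc ih =>
        refine ih.trans (SimpleGraph.Adj.reachable ?_)
        rw [openGraph_adj, mem_restrictConfig, Sym2.map_mk] at hbc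
        rw [openGraph_adj]
        exact ⟨hbc.1, fun h' => hbc.2 (Fin.castAdd_injective n k h')⟩

/-- Pattern events of the cloned marking are, almost surely, the pulled-back pattern events of the old marking. [this work] -/
theorem preimage_pev_ae (Φ : (Fin k → Fin k → Bool) → Bool) :
    (restrictConfig (Fin.castAdd k) ⁻¹' pev Φ x : Set (BondConfig (Fin (n + k)))) =ᵐ[prodBernoulli (cloneWeight w x)]
      pev Φ (Fin.castAdd k ∘ x) := by
  refine Filter.eventuallyEq_set.2 ?_
  filter_upwards [ae_good (cloneWeight w x)] with ω hω
  rw [Set.mem_preimage, mem_pev_iff, mem_pev_iff]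
  have hm : (fun i j => decide (restrictConfig (Fin.castAdd k) ω ∈ openConn (x i) (x j))) =
      (fun i j => decide (ω ∈ openConn ((Fin.castAdd k ∘ x) i) ((Fin.castAdd k ∘ x) j))) := by
    funext i j
    exact Bool.decide_congr (reachable_castAdd_iff w x hω (x i) (x j)).symm
  rw [hm]

/-- **`E₃` of pattern events is unchanged by cloning.** [this work] -/
theorem sahiE3_clone (Φ₁ Φ₂ Φ₃ : (Fin k → Fin k → Bool) → Bool) :
    sahiE3 (prodBernoulli (cloneWeight w x)) (pev Φ₁ (Fin.castAdd k ∘ x)) (pev Φ₂ (Fin.castAdd k ∘ x))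
        (pev Φ₃ (Fin.castAdd k ∘ x)) = sahiE3 (prodBernoulli w) (pev Φ₁ x) (pev Φ₂ x) (pev Φ₃ x) := by
  rw [← sahiE3_congr_ae (preimage_pev_ae w x Φ₁) (preimage_pev_ae w x Φ₂) (preimage_pev_ae w x Φ₃)]
  simp only [sahiE3, ← Set.preimage_inter, real_preimage_restrictConfig_cloneWeight]

/-- **The cloned marking has spares**: the clone of terminal `i` hangs on it by a weight-one edge and is not a terminal. [this work] -/
theorem hasSpare_clone : HasSpare (cloneWeight w x) (Fin.castAdd k ∘ x) := by
  intro i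
  refine ⟨Fin.natAdd n i, SimpleGraph.Adj.reachable ?_, fun j => CILSharpHardness.castAdd_ne_natAdd (x j) i⟩
  rw [openGraph_adj]
  refine ⟨?_, CILSharpHardness.castAdd_ne_natAdd (x i) i⟩
  show cloneWeight w x s((Fin.castAdd k ∘ x) i, Fin.natAdd n i) = 1
  rw [Function.comp_apply, Sym2.eq_swap]
  exact cloneWeight_clone w x i

end Clone

/-! ### The unmarked-edge schema, unconditionally -/

/-- **THE UNMARKED-EDGE INDUCTION SCHEMA.**  For three `k`-terminal pattern predicates, if for EVERY number of vertices the polarised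
Bernstein coefficients of `E₃` are nonnegative at every edge from a terminal to an UNMARKED vertex (given `E₃ ≥ 0` under the two updated
weights, `UnmarkedEdgeHyp`), then `0 ≤ E₃` at every injective marking of every finite weighted graph.  (Apply the invariant version one
dimension up, to the cloned graph.) [this work] -/
theorem sahiE3_pev_nonneg_of_unmarkedEdgeHyp (Φ₁ Φ₂ Φ₃ : (Fin k → Fin k → Bool) → Bool)
    (h : ∀ m : ℕ, UnmarkedEdgeHyp (fun x : Fin k → Fin m => pev Φ₁ x) (fun x => pev Φ₂ x) (fun x => pev Φ₃ x))
    (w : Sym2 (Fin n) → unitInterval) (x : Fin k → Fin n) (hx : Function.Injective x) :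
    0 ≤ sahiE3 (prodBernoulli w) (pev Φ₁ x) (pev Φ₂ x) (pev Φ₃ x) := by
  rw [← sahiE3_clone w x Φ₁ Φ₂ Φ₃]
  exact sahiE3_nonneg_of_unmarkedEdgeHyp_of_hasSpare (isLocal_pev Φ₁) (isLocal_pev Φ₂) (isLocal_pev Φ₃) (h (n + k))
    (cloneWeight w x) (Fin.castAdd k ∘ x) ((Fin.castAdd_injective n k).comp hx) (hasSpare_clone w x)

/-- **Group-separation rows.**  For three group separations `D[X₁|Y₁], D[X₂|Y₂], D[X₃|Y₃]` of sub-lists of `k` terminals (index lists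
`Iⱼ, Jⱼ`), the unmarked-edge hypotheses for all `n` give `0 ≤ E₃` at every injective marking of every finite weighted graph. [this work] -/
theorem sahiE3_sep_nonneg_of_unmarkedEdgeHyp (I₁ J₁ I₂ J₂ I₃ J₃ : List (Fin k))
    (h : ∀ m : ℕ, UnmarkedEdgeHyp (fun x : Fin k → Fin m => connEvent (sep (I₁.map x) (J₁.map x)))
      (fun x => connEvent (sep (I₂.map x) (J₂.map x))) (fun x => connEvent (sep (I₃.map x) (J₃.map x))))
    (w : Sym2 (Fin n) → unitInterval) (x : Fin k → Fin n) (hx : Function.Injective x) :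
    0 ≤ sahiE3 (prodBernoulli w) (connEvent (sep (I₁.map x) (J₁.map x))) (connEvent (sep (I₂.map x) (J₂.map x)))
      (connEvent (sep (I₃.map x) (J₃.map x))) := by
  have e : ∀ (m : ℕ) (I J : List (Fin k)), (fun x : Fin k → Fin m => connEvent (sep (I.map x) (J.map x))) = fun x => pev (sepPat I J) x :=
    fun m I J => funext fun x => (pev_sepPat I J x).symm
  rw [← pev_sepPat, ← pev_sepPat, ← pev_sepPat]
  refine sahiE3_pev_nonneg_of_unmarkedEdgeHyp _ _ _ (fun m => ?_) w x hx
  rw [← e m I₁ J₁, ← e m I₂ J₂, ← e m I₃ J₃]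
  exact h m

/-! ### The 45 four-point decreasing frontier rows -/

/-- **Every frontier row, for ALL `n`, from its (terminal, UNMARKED) edge forms alone.**  If for every number of vertices the polarised
Bernstein coefficients of row `i` are nonnegative at every edge from a terminal to an unmarked vertex (given the induction hypotheses;
`UnmarkedEdgeHyp`, families of the marking `(a,b,c,y) = (x 0, x 1, x 2, x 3)`), then `0 ≤ E₃(D₁, D₂, D₃)` for the representative triple
`FrontierDecRows.row i` at every pairwise distinct `a b c y` of every finite weighted graph — for the seven open rows `12, 15, 27, 30, 36 (PATH),
37, 44` the standing reduction of the all-`n` statement to cubic inequalities in ONE five-point (52-cell) law. [this work] -/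
theorem frontier_all_of_unmarkedEdgeHyp (i : Fin 45)
    (h : ∀ m : ℕ, UnmarkedEdgeHyp (fun x : Fin 4 → Fin m => connEvent (FrontierDecRows.row i m (x 0, x 1, x 2, x 3)).1)
      (fun x => connEvent (FrontierDecRows.row i m (x 0, x 1, x 2, x 3)).2.1)
      (fun x => connEvent (FrontierDecRows.row i m (x 0, x 1, x 2, x 3)).2.2))
    (w : Sym2 (Fin n) → unitInterval) (a b c y : Fin n) (hab : a ≠ b) (hac : a ≠ c) (hay : a ≠ y) (hbc : b ≠ c)
    (hby : b ≠ y) (hcy : c ≠ y) :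
    0 ≤ sahiE3 (prodBernoulli w) (connEvent (FrontierDecRows.row i n (a, b, c, y)).1)
      (connEvent (FrontierDecRows.row i n (a, b, c, y)).2.1) (connEvent (FrontierDecRows.row i n (a, b, c, y)).2.2) := by
  have hx := injective_vec4 hab hac hay hbc hby hcy
  fin_cases i
  · exact sahiE3_sep_nonneg_of_unmarkedEdgeHyp [0, 1, 2] [3] [0, 1, 3] [2] [0, 2] [1] h w ![a, b, c, y] hx
  · exact sahiE3_sep_nonneg_of_unmarkedEdgeHyp [0, 1, 2] [3] [0, 1] [2] [0, 2] [1, 3] h w ![a, b, c, y] hx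
  · exact sahiE3_sep_nonneg_of_unmarkedEdgeHyp [0, 1, 2] [3] [0, 1] [2] [0, 3] [1] h w ![a, b, c, y] hx
  · exact sahiE3_sep_nonneg_of_unmarkedEdgeHyp [0, 1, 2] [3] [0, 1] [2, 3] [0, 3] [1] h w ![a, b, c, y] hx
  · exact sahiE3_sep_nonneg_of_unmarkedEdgeHyp [0, 1, 2] [3] [0, 3] [1] [0] [2] h w ![a, b, c, y] hx
  · exact sahiE3_sep_nonneg_of_unmarkedEdgeHyp [0, 1, 2] [3] [0, 3] [1] [0] [2, 3] h w ![a, b, c, y] hx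
  · exact sahiE3_sep_nonneg_of_unmarkedEdgeHyp [0, 1, 2] [3] [0, 3] [1] [1] [2] h w ![a, b, c, y] hx
  · exact sahiE3_sep_nonneg_of_unmarkedEdgeHyp [0, 1] [2] [0, 1] [3] [0, 2] [1] h w ![a, b, c, y] hx
  · exact sahiE3_sep_nonneg_of_unmarkedEdgeHyp [0, 1] [2] [0, 1] [3] [0, 2] [3] h w ![a, b, c, y] hx
  · exact sahiE3_sep_nonneg_of_unmarkedEdgeHyp [0, 1] [2] [0, 2] [1] [1, 3] [2] h w ![a, b, c, y] hx
  · exact sahiE3_sep_nonneg_of_unmarkedEdgeHyp [0, 1] [2] [0, 2] [1] [1] [3] h w ![a, b, c, y] hx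
  · exact sahiE3_sep_nonneg_of_unmarkedEdgeHyp [0, 1] [2] [0, 2] [1, 3] [0, 3] [1] h w ![a, b, c, y] hx
  · exact sahiE3_sep_nonneg_of_unmarkedEdgeHyp [0, 1] [2] [0, 2] [1, 3] [1] [3] h w ![a, b, c, y] hx
  · exact sahiE3_sep_nonneg_of_unmarkedEdgeHyp [0, 1] [2] [0, 2] [3] [0] [1] h w ![a, b, c, y] hx
  · exact sahiE3_sep_nonneg_of_unmarkedEdgeHyp [0, 1] [2] [0, 2] [3] [0] [1, 3] h w ![a, b, c, y] hx
  · exact sahiE3_sep_nonneg_of_unmarkedEdgeHyp [0, 1] [2] [0, 2] [3] [1] [3] h w ![a, b, c, y] hx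
  · exact sahiE3_sep_nonneg_of_unmarkedEdgeHyp [0, 1] [2] [0, 3] [2] [0] [1] h w ![a, b, c, y] hx
  · exact sahiE3_sep_nonneg_of_unmarkedEdgeHyp [0, 1] [2] [0] [1] [0] [2, 3] h w ![a, b, c, y] hx
  · exact sahiE3_sep_nonneg_of_unmarkedEdgeHyp [0, 1] [2] [0] [1] [0] [3] h w ![a, b, c, y] hx
  · exact sahiE3_sep_nonneg_of_unmarkedEdgeHyp [0, 1] [2] [0] [3] [2] [3] h w ![a, b, c, y] hx
  · exact sahiE3_sep_nonneg_of_unmarkedEdgeHyp [0, 1, 2] [3] [0, 1, 3] [2] [0, 2] [1, 3] h w ![a, b, c, y] hx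
  · exact sahiE3_sep_nonneg_of_unmarkedEdgeHyp [0, 1, 2] [3] [0, 1] [2] [0, 2] [1] h w ![a, b, c, y] hx
  · exact sahiE3_sep_nonneg_of_unmarkedEdgeHyp [0, 1, 2] [3] [0, 1] [2] [0] [1] h w ![a, b, c, y] hx
  · exact sahiE3_sep_nonneg_of_unmarkedEdgeHyp [0, 1, 2] [3] [0, 1] [2, 3] [0] [1] h w ![a, b, c, y] hx
  · exact sahiE3_sep_nonneg_of_unmarkedEdgeHyp [0, 1, 2] [3] [0, 3] [1] [0, 3] [2] h w ![a, b, c, y] hx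
  · exact sahiE3_sep_nonneg_of_unmarkedEdgeHyp [0, 1, 2] [3] [0, 3] [1] [1] [2, 3] h w ![a, b, c, y] hx
  · exact sahiE3_sep_nonneg_of_unmarkedEdgeHyp [0, 1, 2] [3] [0] [1] [0] [2] h w ![a, b, c, y] hx
  · exact sahiE3_sep_nonneg_of_unmarkedEdgeHyp [0, 1] [2] [0, 1] [3] [0, 2] [1, 3] h w ![a, b, c, y] hx
  · exact sahiE3_sep_nonneg_of_unmarkedEdgeHyp [0, 1] [2] [0, 2] [1] [0] [3] h w ![a, b, c, y] hx
  · exact sahiE3_sep_nonneg_of_unmarkedEdgeHyp [0, 1] [2] [0, 2] [1] [1, 2] [3] h w ![a, b, c, y] hx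
  · exact sahiE3_sep_nonneg_of_unmarkedEdgeHyp [0, 1] [2] [0, 2] [1, 3] [1] [2, 3] h w ![a, b, c, y] hx
  · exact sahiE3_sep_nonneg_of_unmarkedEdgeHyp [0, 1] [2] [0, 2] [3] [1, 2] [3] h w ![a, b, c, y] hx
  · exact sahiE3_sep_nonneg_of_unmarkedEdgeHyp [0, 1] [2] [0, 3] [2] [1] [3] h w ![a, b, c, y] hx
  · exact sahiE3_sep_nonneg_of_unmarkedEdgeHyp [0, 1] [2] [0] [1] [2] [3] h w ![a, b, c, y] hx
  · exact sahiE3_sep_nonneg_of_unmarkedEdgeHyp [0, 1] [2] [0] [2, 3] [1] [3] h w ![a, b, c, y] hx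
  · exact sahiE3_sep_nonneg_of_unmarkedEdgeHyp [0, 1] [2] [0] [3] [1] [3] h w ![a, b, c, y] hx
  · exact sahiE3_sep_nonneg_of_unmarkedEdgeHyp [0] [1] [0] [2] [1] [3] h w ![a, b, c, y] hx
  · exact sahiE3_sep_nonneg_of_unmarkedEdgeHyp [0, 1] [2] [0, 2] [3] [0, 3] [1] h w ![a, b, c, y] hx
  · exact sahiE3_sep_nonneg_of_unmarkedEdgeHyp [0, 1, 2] [3] [0, 1, 3] [2] [0] [1] h w ![a, b, c, y] hx
  · exact sahiE3_sep_nonneg_of_unmarkedEdgeHyp [0, 1] [2] [0, 1] [3] [0] [1] h w ![a, b, c, y] hx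
  · exact sahiE3_sep_nonneg_of_unmarkedEdgeHyp [0, 1] [2] [0, 1] [3] [2] [3] h w ![a, b, c, y] hx
  · exact sahiE3_sep_nonneg_of_unmarkedEdgeHyp [0, 1, 2] [3] [0, 1, 3] [2] [0, 2, 3] [1] h w ![a, b, c, y] hx
  · exact sahiE3_sep_nonneg_of_unmarkedEdgeHyp [0] [1] [0] [2] [0] [3] h w ![a, b, c, y] hx
  · exact sahiE3_sep_nonneg_of_unmarkedEdgeHyp [0] [1] [0] [2] [1] [2] h w ![a, b, c, y] hx
  · exact sahiE3_sep_nonneg_of_unmarkedEdgeHyp [0, 1] [2, 3] [0] [1] [2] [3] h w ![a, b, c, y] hx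

end TerminalEdgeInduction

end Summit.CriticalPhenomena.PercolationContinuityZ3.Theorems
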